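import Literature.AlgebraicGeometry.Resolution.MuPTorsorLocalUniformizationNonAbhyankar
import Literature.AlgebraicGeometry.Resolution.ArithmeticalThreefolds
import Literature.AlgebraicGeometry.Resolution.AffineDomainDimension
import HarnessLib

/-!
# The core `μ_p`-torsor step: transcendence degree ≥ 4, non-Abhyankar, genuinely radical

**Sources.** M. Temkin, *Inseparable local uniformization*, J. Algebra **373** (2013) 65–119,
arXiv:0804.1554, Thm. 1.3.2 / Rem. 1.3.5 (ii) (named fact `Temkin2013Relative`;
`isLocallyUniformizable_of_muPTorsorStepsAt_of_relative`); S. D. Cutkosky, *Local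
uniformization of Abhyankar valuations*, Michigan Math. J. **71** (2022), Thm. 1.3 (PROVED in
the tree, `Cutkosky2022_Thm13_holds`); V. Cossart, O. Piltant, *Resolution of singularities of
arithmetical threefolds*, J. Algebra **529** (2019) 268–535, Thm. 1.1 with §4.1 (LU) (named fact
`CossartPiltant2019`, here through its corollary `CossartPiltant2019LU3`: local uniformization
in dimension `≤ 3` over every field).

**What is recorded (a combination; no new named fact).** The torsor hypothesis
`MuPTorsorStepsAt p k O` ("local uniformizability climbs `K₀ ⊂ K₀(a)`, `a^p ∈ K₀`, inside `K`")
is needed only for the CORE steps (`MuPTorsorCoreStepsAt`): `a ∉ K₀`, `trdeg_k K₀(a) > 3`, and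
`O ∩ K₀(a)` NOT an Abhyankar place of `K₀(a)/k` — the other steps being settled by
Cossart–Piltant (transcendence degree `≤ 3`) and Cutkosky (Abhyankar places), over an arbitrary
ground field (`muPTorsorStepsAt_of_coreStepsAt`). Consequently, granted `Temkin2013Relative` and
`CossartPiltant2019LU3`, local uniformization in characteristic `p` is EQUIVALENT to the core
steps at all valuation rings over all ground fields of characteristic `p`
(`localUniformizationInChar_iff_coreStepsAt`). This is the typed form of "the open part of local
uniformization in characteristic `p` is the degree-`p` radical step in dimension `≥ 4` at
non-Abhyankar valuations".
-/

noncomputable section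

namespace Literature.AlgebraicGeometry.Resolution

universe u

open IntermediateField

variable {p : ℕ}

/-- **The CORE `μ_p`-torsor steps at one valuation ring** `O` of `K ⊇ k`: for an intermediate
field `K₀` and `a ∈ K ∖ K₀` with `a^p ∈ K₀` such that `K₀(a)` has transcendence degree `> 3`
over `k` and `O ∩ K₀(a)` is not an Abhyankar place of `K₀(a)/k`: if `O ∩ K₀` is locally
uniformizable over `k` then so is `O ∩ K₀(a)`. [cite: Temkin2013, Rem. 1.3.5 (ii)] -/
def MuPTorsorCoreStepsAt (p : ℕ) (k : Type u) {K : Type u} [Field k] [Field K] [Algebra k K]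
    (O : ValuationSubring K) : Prop :=
  ∀ (K₀ : IntermediateField k K) (a : K), a ∉ K₀ → a ^ p ∈ K₀ →
    3 < Algebra.trdeg k ↥(K₀ ⊔ adjoin k {a}) →
    ¬ IsAbhyankarPlace ((O.comap (algebraMap ↥(K₀ ⊔ adjoin k {a}) K)))
        (algebraMap k ↥(K₀ ⊔ adjoin k {a})).fieldRange ⊤ →
    IsLocallyUniformizable k K₀ (O.comap (algebraMap K₀ K)) →
    IsLocallyUniformizable k ↥(K₀ ⊔ adjoin k {a})
      (O.comap (algebraMap ↥(K₀ ⊔ adjoin k {a}) K))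

/-- Torsor steps contain the core steps. [folklore] -/
theorem MuPTorsorStepsAt.coreStepsAt {k K : Type u} [Field k] [Field K] [Algebra k K]
    {O : ValuationSubring K} (H : MuPTorsorStepsAt p k O) : MuPTorsorCoreStepsAt p k O :=
  fun K₀ a _ hap _ _ h => H K₀ a hap h

/-- **Local uniformization in transcendence degree `≤ 3` over any field** (Cossart–Piltant
2019, via `CossartPiltant2019LU3` and `dim = trdeg`), in the vocabulary of
`IsLocallyUniformizable`. [cite: CossartPiltant2019, Thm. 1.1 with §4.1 (LU)] -/
theorem isLocallyUniformizable_of_trdeg_le_three (hCP : CossartPiltant2019LU3.{u})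
    {k K : Type u} [Field k] [Field K] [Algebra k K] (hfg : (⊤ : IntermediateField k K).FG)
    (O : ValuationSubring K) (hk : ∀ c : k, algebraMap k K c ∈ O)
    (hd : Algebra.trdeg k K ≤ 3) : IsLocallyUniformizable k K O := by
  obtain ⟨A, hAO, hAfg, hAfr⟩ := exists_affineModel k K hfg O hk
  haveI := hAfr
  exact (hCP k).isLocallyUniformizable K O A hAO hAfg hAfr
    (ringKrullDim_le_of_fg_of_trdeg_le A hAfg (d := 3) (by exact_mod_cast hd))

/-- A trivial step: if `a ∈ K₀` then `O ∩ K₀(a) = O ∩ K₀` is locally uniformizable when `O ∩ K₀`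
is. [folklore] -/
theorem isLocallyUniformizable_sup_adjoin_of_mem {k K : Type u} [Field k] [Field K]
    [Algebra k K] (O : ValuationSubring K) {K₀ : IntermediateField k K} {a : K} (ha : a ∈ K₀)
    (h : IsLocallyUniformizable k K₀ (O.comap (algebraMap K₀ K))) :
    IsLocallyUniformizable k ↥(K₀ ⊔ adjoin k {a})
      (O.comap (algebraMap ↥(K₀ ⊔ adjoin k {a}) K)) := by
  have hEq : K₀ = K₀ ⊔ adjoin k {a} := by
    refine le_antisymm le_sup_left (sup_le le_rfl ?_)
    exact adjoin_le_iff.mpr (Set.singleton_subset_iff.mpr ha)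
  let e : (K₀ : IntermediateField k K) ≃ₐ[k] ↥(K₀ ⊔ adjoin k {a}) := equivOfEq hEq
  refine IsLocallyUniformizable.of_ringEquiv (e : K₀ ≃+* ↥(K₀ ⊔ adjoin k {a}))
    (RingEquiv.refl k) (fun c => ?_) _ ?_
  · simp
  · have hO : (O.comap (algebraMap ↥(K₀ ⊔ adjoin k {a}) K)).comap
        ((e : K₀ ≃+* ↥(K₀ ⊔ adjoin k {a})) : K₀ →+* ↥(K₀ ⊔ adjoin k {a})) =
        O.comap (algebraMap K₀ K) := by
      ext x
      rfl
    rw [hO]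
    exact h

/-- **Core steps suffice for all torsor steps**, over an arbitrary ground field, granted local
uniformization in dimension `≤ 3` (Cossart–Piltant 2019): the steps with `a ∈ K₀` are trivial,
those with `trdeg_k K₀(a) ≤ 3` are Cossart–Piltant, and those at which `O ∩ K₀(a)` is an
Abhyankar place are Cutkosky 2022 (proved in the tree).
[cite: Temkin2013, Rem. 1.3.5 (ii); Cutkosky2022, Thm. 1.3; CossartPiltant2019, Thm. 1.1] -/
theorem muPTorsorStepsAt_of_coreStepsAt (hCP : CossartPiltant2019LU3.{u}) {k K : Type u}
    [Field k] [Field K] [Algebra k K] (O : ValuationSubring K)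
    (hk : ∀ c : k, algebraMap k K c ∈ O) (H : MuPTorsorCoreStepsAt p k O) :
    MuPTorsorStepsAt p k O := by
  intro K₀ a hap hLU
  by_cases ha : a ∈ K₀
  · exact isLocallyUniformizable_sup_adjoin_of_mem O ha hLU
  -- `K₀(a)` is finitely generated over `k` and contains `k` inside `O`
  have hK₀fg : K₀.FG := intermediateField_fg_of_fg_top K₀ hLU.fg_top
  have hMfg : (K₀ ⊔ adjoin k {a}).FG :=
    IntermediateField.fg_sup hK₀fg (by
      simpa using IntermediateField.fg_adjoin_finset (F := k) ({a} : Finset K))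
  have hfg' : (⊤ : IntermediateField k ↥(K₀ ⊔ adjoin k {a})).FG :=
    intermediateField_fg_top_of_fg _ hMfg
  have hk' : ∀ c : k, algebraMap k ↥(K₀ ⊔ adjoin k {a}) c ∈
      O.comap (algebraMap ↥(K₀ ⊔ adjoin k {a}) K) := fun c => by
    rw [ValuationSubring.mem_comap, ← IsScalarTower.algebraMap_apply]
    exact hk c
  by_cases hd : Algebra.trdeg k ↥(K₀ ⊔ adjoin k {a}) ≤ 3
  · exact isLocallyUniformizable_of_trdeg_le_three hCP hfg' _ hk' hd
  by_cases hA : IsAbhyankarPlace ((O.comap (algebraMap ↥(K₀ ⊔ adjoin k {a}) K)))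
      (algebraMap k ↥(K₀ ⊔ adjoin k {a})).fieldRange ⊤
  · exact isLocallyUniformizable_of_isAbhyankarPlace hfg' _ hk' hA
  · exact H K₀ a ha hap (lt_of_not_ge hd) hA hLU

/-- **Local uniformization at one valuation ring from its core steps** (arbitrary ground field
of characteristic `p`; Temkin (relative) + Cossart–Piltant (dim `≤ 3`) + Cutkosky (Abhyankar)).
[cite: Temkin2013, Rem. 1.3.5 (ii); CossartPiltant2019, Thm. 1.1; Cutkosky2022, Thm. 1.3] -/
theorem isLocallyUniformizable_of_coreStepsAt [Fact p.Prime] (hT : Temkin2013Relative.{u})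
    (hCP : CossartPiltant2019LU3.{u}) {k K : Type u} [Field k] [CharP k p] [Field K]
    [Algebra k K] (hfg : (⊤ : IntermediateField k K).FG) (O : ValuationSubring K)
    (hk : ∀ c : k, algebraMap k K c ∈ O) (H : MuPTorsorCoreStepsAt p k O) :
    IsLocallyUniformizable k K O :=
  isLocallyUniformizable_of_muPTorsorStepsAt_of_relative hT hfg O hk
    (muPTorsorStepsAt_of_coreStepsAt hCP O hk H)

/-- **Local uniformization in characteristic `p` ⟺ the core `μ_p`-torsor steps** (transcendence
degree `> 3`, non-Abhyankar, `a ∉ K₀`) at every valuation ring over every ground field of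
characteristic `p` — granted Temkin's relative theorem and Cossart–Piltant's local
uniformization in dimension `≤ 3`.
[cite: Temkin2013, Rem. 1.3.5 (ii); CossartPiltant2019, Thm. 1.1; Cutkosky2022, Thm. 1.3] -/
theorem localUniformizationInChar_iff_coreStepsAt [Fact p.Prime] (hT : Temkin2013Relative.{u})
    (hCP : CossartPiltant2019LU3.{u}) :
    LocalUniformizationInChar.{u} p ↔
      ∀ (k K : Type u) [Field k] [CharP k p] [Field K] [Algebra k K],
        (⊤ : IntermediateField k K).FG →
        ∀ O : ValuationSubring K, (∀ c : k, algebraMap k K c ∈ O) →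
          MuPTorsorCoreStepsAt p k O :=
  ⟨fun h k K _ _ _ _ _ O _ => (h.muPTorsorInChar k K O).coreStepsAt,
    fun h k K _ _ _ _ hfg O hk => isLocallyUniformizable_of_coreStepsAt hT hCP hfg O hk
      (h k K hfg O hk)⟩

/-- The same with the parent named fact `CossartPiltant2019` is immediate for users holding
`CossartPiltant2019LU3`; we also record the pointwise form with the torsor statement over all
fields: `MuPTorsorLocalUniformizationInChar p` follows from the core steps everywhere.
[cite: CossartPiltant2019, Thm. 1.1] -/
theorem muPTorsorLocalUniformizationInChar_of_coreStepsAt (hCP : CossartPiltant2019LU3.{u})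
    (H : ∀ (k K : Type u) [Field k] [CharP k p] [Field K] [Algebra k K]
      (O : ValuationSubring K), (∀ c : k, algebraMap k K c ∈ O) → MuPTorsorCoreStepsAt p k O) :
    MuPTorsorLocalUniformizationInChar.{u} p := by
  intro k K _ _ _ _ O K₀ a hap hLU
  have hk : ∀ c : k, algebraMap k K c ∈ O := by
    obtain ⟨A, hA, -, -, -⟩ := hLU
    intro c
    have h1 : algebraMap K₀ K (algebraMap k K₀ c) ∈ O := hA (A.algebraMap_mem c)
    rwa [← IsScalarTower.algebraMap_apply] at h1
  exact muPTorsorStepsAt_of_coreStepsAt hCP O hk (H k K O hk) K₀ a hap hLU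

end Literature.AlgebraicGeometry.Resolution

end
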